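import Mathlib.Data.Real.Basic
import Mathlib.Tactic.Linarith
import Mathlib.Tactic.Ring
import Mathlib.Tactic.Positivity
import HarnessLib

/-!
# The two-sided cluster bound (TCB) follows from a ONE-SIDED reverse-Harris inequality (algebraic core)

Support file for crux `stmt-CriticalPhenomena-4575` (`NoHeavyLowerTail`), seat `prim-l12-p1` gen 24 (`--supports stmt-CriticalPhenomena-4575`);
sequel of `…IncStarTwoSidedClusterBound` (prim-nh-lead-4575 gen 125: TCB ⟹ TT-CHORD for `E₃`).  Memo
`run/shared/lean/prim/prim-l12/FROM-prim-l12-p1-g24-TCB-SUPERTERMINAL.md` §2.  No definitions, no sorries, standard axioms; pure real arithmetic.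

SETTING (paper level; cells of the `{s,a,b,c}` connection law, root `s`, targets `a, b`, observer `c`): `v = P(F₁)`, `u = P(F₂)` with
`F₁ = {s∼a ∧ s≁b}`, `F₂ = {s∼b ∧ s≁a}`; `n₁ = P(F₁ ∧ E₁) = x₂ + x₃`, `n₂ = P(F₂ ∧ E₂) = y₂ + y₃` with `E₁ = {c∼s} ∪ {c∼b}`,
`E₂ = {c∼s} ∪ {c∼a}`; `e₁ = P(E₁)`, `e₂ = P(E₂)`, `pc = P(c∼s)` (so `pc ≤ e₁`, `pc ≤ e₂`); `m = P(c ∼ {s,a,b})` (so `eᵢ ≤ m`).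
TCB (lead gen 125) is `pc·u·v ≤ u·n₁ + v·n₂`, i.e. `P(E₁ | F₁) + P(E₂ | F₂) ≥ P(c∼s)`.

* `tcb_of_oneSided` — if `κ·e₁·v ≤ n₁` and `κ·e₂·u ≤ n₂` for some `κ ≥ ½` (the one-sided row `TCB'_κ`: `P(E₁ | F₁) ≥ κ·P(E₁)`, and its
  mirror image under `a ↔ b`), then TCB holds; with `κ = ⅔` one even gets `TCB_{4/3}`: `4·pc·u·v ≤ 3(u·n₁ + v·n₂)` (`tcb43_of_oneSided`).
* `oneSided_of_superTerminal` — `TCB'_κ` follows from the super-terminal row `P3_κ`: `P(c∼{s,a,b} | F₁) ≥ κ·P(c∼{s,a,b})`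
  (under `F₁` the events `E₁` and `c∼{s,a,b}` coincide, and `P(E₁) ≤ P(c∼{s,a,b})`).
So the conjectural chain of the memo reads, in the kernel: `P3_{1/2}` (both mirror images) ⟹ `TCB'_{1/2}` ⟹ TCB ⟹ TT-CHORD(`E₃`)
(`IncStar.ttChord_nonneg_of_TCB`).
-/

namespace Summit.CriticalPhenomena.PercolationContinuityZ3.Theorems

namespace IncStar

/-- **One-sided ⟹ two-sided.**  If `κ ≥ ½`, `κ·e₁·v ≤ n₁`, `κ·e₂·u ≤ n₂`, `pc ≤ e₁`, `pc ≤ e₂` and `u, v, pc ≥ 0`, then the cleared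
two-sided cluster bound `pc·u·v ≤ u·n₁ + v·n₂` holds. [this work] -/
theorem tcb_of_oneSided (κ u v n1 n2 e1 e2 pc : ℝ) (hκ : 1 / 2 ≤ κ) (hu : 0 ≤ u) (hv : 0 ≤ v) (hpc : 0 ≤ pc)
    (he1 : pc ≤ e1) (he2 : pc ≤ e2) (h1 : κ * e1 * v ≤ n1) (h2 : κ * e2 * u ≤ n2) :
    pc * u * v ≤ u * n1 + v * n2 := by
  have huv : 0 ≤ u * v := mul_nonneg hu hv
  have a1 : κ * pc * (u * v) ≤ u * n1 := by
    have := mul_le_mul_of_nonneg_left h1 hu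
    nlinarith [mul_le_mul_of_nonneg_left he1 (mul_nonneg (by linarith : (0:ℝ) ≤ κ) huv)]
  have a2 : κ * pc * (u * v) ≤ v * n2 := by
    have := mul_le_mul_of_nonneg_left h2 hv
    nlinarith [mul_le_mul_of_nonneg_left he2 (mul_nonneg (by linarith : (0:ℝ) ≤ κ) huv)]
  nlinarith [mul_nonneg hpc huv]

/-- **`κ = ⅔` gives `TCB_{4/3}`**: `4·pc·u·v ≤ 3(u·n₁ + v·n₂)`. [this work] -/
theorem tcb43_of_oneSided (u v n1 n2 e1 e2 pc : ℝ) (hu : 0 ≤ u) (hv : 0 ≤ v)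
    (he1 : pc ≤ e1) (he2 : pc ≤ e2) (h1 : 2 / 3 * e1 * v ≤ n1) (h2 : 2 / 3 * e2 * u ≤ n2) :
    4 * (pc * u * v) ≤ 3 * (u * n1 + v * n2) := by
  have huv : 0 ≤ u * v := mul_nonneg hu hv
  have a1 : 2 / 3 * pc * (u * v) ≤ u * n1 := by
    have := mul_le_mul_of_nonneg_left h1 hu
    nlinarith [mul_le_mul_of_nonneg_left he1 huv]
  have a2 : 2 / 3 * pc * (u * v) ≤ v * n2 := by
    have := mul_le_mul_of_nonneg_left h2 hv
    nlinarith [mul_le_mul_of_nonneg_left he2 huv]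
  nlinarith

/-- **Super-terminal row ⟹ one-sided row.**  If `κ·m·v ≤ n₁` with `e₁ ≤ m` (`m = P(c∼{s,a,b})`, `e₁ = P(c∼s ∨ c∼b)`; under `F₁` both events
coincide, so the joint mass `n₁` is the same) and `κ, v ≥ 0`, then `κ·e₁·v ≤ n₁`. [this work] -/
theorem oneSided_of_superTerminal (κ v n1 e1 m : ℝ) (hκ : 0 ≤ κ) (hv : 0 ≤ v) (hem : e1 ≤ m) (h : κ * m * v ≤ n1) :
    κ * e1 * v ≤ n1 := by
  nlinarith [mul_le_mul_of_nonneg_left hem (mul_nonneg hκ hv)]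

end IncStar

end Summit.CriticalPhenomena.PercolationContinuityZ3.Theorems
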